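import Literature.Analysis.FluidPDE.WholeSpaceIBP
import Literature.Analysis.FluidPDE.DistributionalPressurePoisson
import Literature.Analysis.FluidPDE.PressurePoisson
import Literature.Analysis.FluidPDE.SelfSimilar
import HarnessLib

/-!
# Galdi's Liouville problem ⟨0895⟩, line «all-axes cylinder budget», piece O1c (1/·):
# the steady momentum equation TESTED WITH A GRADIENT FIELD

Route `GaldiLiouvilleGate` (NavierStokesRegularity), items ⟨0895⟩ `GaldiLiouville` (census S1) / ⟨0896⟩
`AxisymGaldiLiouville` (S3); LINE allaxes v1 (pub/ideators/ns-idea-4/lines/allaxes, a43dd9fd9097dedf),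
obligation O1c `CylinderBookkeeping : PressureHessianIntegrable → HeadMaximumPrinciple → CylinderBudget`
(director-ns #208 (1)(a); critic idea-crit-3, re-derivation 2026-08-28T10:28:59Z).  The cylinder
bookkeeping is done WITHOUT surface integrals: every cylinder identity of the line is the steady
equation tested with the gradient of a compactly supported function of `(r, z)`.  This file is the
first, symmetry-free and dimension-free step:

* `integral_sub_mul_laplacian_add_hessian_eq_zero` — for a classical steady pair
  `−νΔU + (U·∇)U + ∇P = 0`, `div U = 0` (the tree's `IsLerayProfile ν 0 U P`) and every `ψ ∈ C³_c(E)`,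
  and every constant `c`,
  `∫ (P − c) Δψ + ∫ D²ψ(U, U) = 0`.
  The viscous term vanishes IDENTICALLY against gradients: `∫⟪ΔU, ∇ψ⟫ = ∫⟪U, ∇Δψ⟫ = −∫ (div U) Δψ = 0`
  (tree `WholeSpaceIBP`: Green without boundary twice, `laplacian_gradient`, `∫ θ div U + ∫⟪U,∇θ⟫ = 0`);
  the convective term is `∫⟪(U·∇)U, ∇ψ⟫ = −∫⟪U, (U·∇)∇ψ⟫ = −∫ D²ψ(U,U)` (trilinear identity, `div U = 0`,
  `inner_fderiv_gradient_apply`); the pressure term is `∫⟪∇P, ∇ψ⟫ = −∫ P Δψ` and `∫ Δψ = 0`.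
  (This is the classical form of the pressure Poisson equation `Δp = −∂ᵢ∂ⱼ(uᵢuⱼ)` tested with `ψ`;
  the tree has the distributional-solution version `…integral_hessian_add_pressure_laplacian_eq_zero`.)

[folklore; cite: Galdi2011, Thm X.5.1 / X.9.5 (steady D-solutions); KorobkovPileckasRusso2015 = W. Wang's
monograph Thm 3.5–3.6 (the cylinder identities this serves)]

No summit / no ⟨0895⟩–⟨0896⟩ claim is proved here; NS regularity is not touched.
-/

noncomputable section

-- the problem directory repeats the summit name (D-0017); core's `dupNamespace` linter fires
set_option linter.dupNamespace false

open MeasureTheory Set Filter Topology InnerProductSpace Function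
open scoped RealInnerProductSpace Laplacian

namespace Summit.NavierStokesRegularity.NavierStokesRegularity.Theorems.GaldiLiouville.AllAxesBudget

open Literature.Analysis.FluidPDE

variable {E : Type*} [NormedAddCommGroup E] [InnerProductSpace ℝ E] [FiniteDimensional ℝ E]
  [MeasurableSpace E] [BorelSpace E]

omit [MeasurableSpace E] [BorelSpace E] in
/-- The gradient of a `C^{n+1}` function is `C^n` (Riesz isometry ∘ `fderiv`). [folklore] -/
theorem contDiff_gradient_of_succ {θ : E → ℝ} {n : ℕ} (hθ : ContDiff ℝ (n + 1 : ℕ) θ) :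
    ContDiff ℝ n (gradient θ) :=
  (InnerProductSpace.toDual ℝ E).symm.contDiff.comp (hθ.fderiv_right (m := n) (by norm_cast))

omit [MeasurableSpace E] [BorelSpace E] in
/-- The gradient of a compactly supported function is compactly supported. [folklore] -/
theorem hasCompactSupport_gradient {θ : E → ℝ} (hc : HasCompactSupport θ) :
    HasCompactSupport (gradient θ) :=
  (hc.fderiv (𝕜 := ℝ)).comp_left (g := (InnerProductSpace.toDual ℝ E).symm) (map_zero _)

omit [MeasurableSpace E] [BorelSpace E] in
/-- The Laplacian of a compactly supported function is compactly supported. [folklore] -/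
theorem hasCompactSupport_laplacian {F : Type*} [NormedAddCommGroup F] [InnerProductSpace ℝ F]
    {v : E → F} (hc : HasCompactSupport v) : HasCompactSupport (Δ v) := by
  apply hc.mono'
  intro x hx
  by_contra hxt
  exact hx (laplacian_eq_zero_of_notMem_tsupport hxt)

omit [MeasurableSpace E] [BorelSpace E] in
/-- The Laplacian of a `C^{n+2}` field is `C^n` (sum of pure second partials over an orthonormal
basis). [folklore] -/
theorem contDiff_laplacian {F : Type*} [NormedAddCommGroup F] [InnerProductSpace ℝ F]
    {v : E → F} {n : ℕ} (hv : ContDiff ℝ (n + 2 : ℕ) v) : ContDiff ℝ n (Δ v) := by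
  have h2 : ContDiff ℝ 2 v := hv.of_le (by norm_cast; omega)
  have : Δ v = fun x => ∑ i, fderiv ℝ (fun y => fderiv ℝ v y (stdOrthonormalBasis ℝ E i)) x
      (stdOrthonormalBasis ℝ E i) := funext (laplacian_eq_sum_fderiv_fderiv _ h2)
  rw [this]
  refine ContDiff.sum fun i _ => ?_
  have h1 : ContDiff ℝ (n + 1 : ℕ) (fun y => fderiv ℝ v y (stdOrthonormalBasis ℝ E i)) :=
    (hv.fderiv_right (m := (n + 1 : ℕ)) (by norm_cast)).clm_apply contDiff_const
  exact (h1.fderiv_right (m := n) (by norm_cast)).clm_apply contDiff_const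

/-- **The viscous term vanishes against gradients.** For `U ∈ C²` divergence-free and `ψ ∈ C³_c`,
`∫ ⟪ΔU, ∇ψ⟫ = 0` (Green without boundary twice, `Δ∇ψ = ∇Δψ`, and `∫⟪U, ∇θ⟫ = −∫ θ div U = 0`).
[folklore] -/
theorem integral_inner_laplacian_gradient_eq_zero {U : E → E} (hU : ContDiff ℝ 2 U)
    (hdiv : VectorCalculus.IsDivFree U) {ψ : E → ℝ} (hψ : ContDiff ℝ 3 ψ) (hc : HasCompactSupport ψ) :
    ∫ x, ⟪(Δ U) x, gradient ψ x⟫ = 0 := by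
  haveI : CompleteSpace E := FiniteDimensional.complete ℝ E
  set b := stdOrthonormalBasis ℝ E
  have hg2 : ContDiff ℝ 2 (gradient ψ) := contDiff_gradient_of_succ (n := 2) hψ
  have hg1 : ContDiff ℝ 1 (gradient ψ) := hg2.of_le one_le_two
  have hgc : HasCompactSupport (gradient ψ) := hasCompactSupport_gradient hc
  have hU1 : ContDiff ℝ 1 U := hU.of_le one_le_two
  -- Green twice
  have h1 := integral_inner_laplacian_add_eq_zero b (v := U) (w := gradient ψ) hU hg1 (Or.inr hgc)
  have h2 := integral_inner_laplacian_add_eq_zero b (v := gradient ψ) (w := U) hg2 hU1 (Or.inl hgc)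
  have hsum : ∑ i, ∫ x, ⟪fderiv ℝ U x (b i), fderiv ℝ (gradient ψ) x (b i)⟫ =
      ∑ i, ∫ x, ⟪fderiv ℝ (gradient ψ) x (b i), fderiv ℝ U x (b i)⟫ := by
    refine Finset.sum_congr rfl fun i _ => integral_congr_ae (Eventually.of_forall fun x => ?_)
    exact real_inner_comm _ _
  have h3 : ∫ x, ⟪(Δ U) x, gradient ψ x⟫ = ∫ x, ⟪(Δ (gradient ψ)) x, U x⟫ := by linarith
  rw [h3]
  -- `Δ∇ψ = ∇Δψ` and the divergence constraint
  have hΔψ1 : ContDiff ℝ 1 (Δ ψ) := contDiff_laplacian (n := 1) hψ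
  have hΔψc : HasCompactSupport (Δ ψ) := hasCompactSupport_laplacian hc
  have h4 : ∫ x, ⟪(Δ (gradient ψ)) x, U x⟫ = ∫ x, ⟪U x, gradient (Δ ψ) x⟫ := by
    refine integral_congr_ae (Eventually.of_forall fun x => ?_)
    show ⟪(Δ (gradient ψ)) x, U x⟫ = ⟪U x, gradient (Δ ψ) x⟫
    rw [laplacian_gradient hψ x, real_inner_comm]
  rw [h4]
  have h5 := integral_mul_divergence_add_eq_zero_left (θ := Δ ψ) (u := U) hΔψ1 hU1 hΔψc
  have h6 : ∫ x, (Δ ψ) x * VectorCalculus.divergence U x = 0 := by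
    simp [hdiv _]
  linarith

/-- **The steady equation tested with a gradient field** (= the pressure Poisson equation in weak form,
for classical steady solutions).  `(U, P)` a classical steady Navier–Stokes pair on `E`
(`IsLerayProfile ν 0 U P`: `U ∈ C²`, `P ∈ C¹`, `−νΔU + (U·∇)U + ∇P = 0`, `div U = 0`), `ψ ∈ C³_c(E)`,
`c ∈ ℝ`: `∫ (P − c) Δψ + ∫ D²ψ(U, U) = 0`. [folklore; cite: Galdi2011, Thm X.5.1] -/
theorem integral_sub_mul_laplacian_add_hessian_eq_zero {ν : ℝ} {U : E → E} {P : E → ℝ}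
    (h : IsLerayProfile ν 0 U P) {ψ : E → ℝ} (hψ : ContDiff ℝ 3 ψ) (hc : HasCompactSupport ψ) (c : ℝ) :
    (∫ x, (P x - c) * (Δ ψ) x) + ∫ x, fderiv ℝ (fderiv ℝ ψ) x (U x) (U x) = 0 := by
  haveI : CompleteSpace E := FiniteDimensional.complete ℝ E
  have hU2 : ContDiff ℝ 2 U := h.contDiff_velocity
  have hU1 : ContDiff ℝ 1 U := hU2.of_le one_le_two
  have hP1 : ContDiff ℝ 1 P := h.contDiff_pressure
  have hψ2 : ContDiff ℝ 2 ψ := hψ.of_le (by norm_cast)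
  have hg2 : ContDiff ℝ 2 (gradient ψ) := contDiff_gradient_of_succ (n := 2) hψ
  have hg1 : ContDiff ℝ 1 (gradient ψ) := hg2.of_le one_le_two
  have hgc : HasCompactSupport (gradient ψ) := hasCompactSupport_gradient hc
  have hgcont : Continuous (gradient ψ) := hg1.continuous
  -- the pointwise equation with `a = 0`: `convect U U + ∇P = ν ΔU`
  have heq : ∀ y, convect U U y + gradient P y = ν • (Δ U) y := fun y => by
    have e := h.profile_eq y
    simp only [zero_smul, add_zero] at e
    rw [← sub_eq_zero, ← e]; abel
  -- integrability of the three tested terms (continuous × compactly supported)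
  have hcsupp : ∀ (f : E → E), Continuous f → Integrable (fun x => ⟪f x, gradient ψ x⟫) volume :=
    fun f hf => (hf.inner hgcont).integrable_of_hasCompactSupport
      (hgc.mono fun x hx => by
        contrapose! hx
        simp only [mem_support, not_not] at hx ⊢
        rw [hx, inner_zero_right])
  have hIc : Integrable (fun x => ⟪convect U U x, gradient ψ x⟫) volume :=
    hcsupp _ ((hU2.continuous_fderiv (by norm_num)).clm_apply hU2.continuous)
  have hIp : Integrable (fun x => ⟪gradient P x, gradient ψ x⟫) volume :=
    hcsupp _ (continuous_gradient_of_contDiff hP1)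
  -- (1) test the equation: `∫⟪convect U U, ∇ψ⟫ + ∫⟪∇P, ∇ψ⟫ = ν ∫⟪ΔU, ∇ψ⟫ = 0`
  have htest : (∫ x, ⟪convect U U x, gradient ψ x⟫) + ∫ x, ⟪gradient P x, gradient ψ x⟫ = 0 := by
    rw [← integral_add hIc hIp]
    have : (fun x => ⟪convect U U x, gradient ψ x⟫ + ⟪gradient P x, gradient ψ x⟫) =
        fun x => ν * ⟪(Δ U) x, gradient ψ x⟫ := by
      funext x
      rw [← inner_add_left, heq x, inner_smul_left]
      simp
    rw [this, integral_const_mul, integral_inner_laplacian_gradient_eq_zero hU2 h.divFree hψ hc, mul_zero]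
  -- (2) the convective term
  have hconv : ∫ x, ⟪convect U U x, gradient ψ x⟫ = -∫ x, fderiv ℝ (fderiv ℝ ψ) x (U x) (U x) := by
    have h3 := integral_inner_convect_add_eq_zero (u := U) (v := U) (w := gradient ψ) hU1 hU1 hg1 hgc
    have hz : ∫ x, VectorCalculus.divergence U x * ⟪U x, gradient ψ x⟫ = 0 := by simp [h.divFree _]
    have hid : ∫ x, ⟪U x, convect U (gradient ψ) x⟫ = ∫ x, fderiv ℝ (fderiv ℝ ψ) x (U x) (U x) := by
      refine integral_congr_ae (Eventually.of_forall fun x => ?_)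
      exact inner_fderiv_gradient_apply hψ2 x (U x)
    linarith
  -- (3) the pressure term
  have hpress : ∫ x, ⟪gradient P x, gradient ψ x⟫ = -∫ x, (P x - c) * (Δ ψ) x := by
    rw [integral_inner_gradient_eq_neg_integral_mul_divergence hP1 hg1 hgc]
    congr 1
    have hdiv : ∀ x, VectorCalculus.divergence (gradient ψ) x = (Δ ψ) x := fun x => divergence_gradient hψ2 x
    simp_rw [hdiv, sub_mul]
    have hI1 : Integrable (fun x => P x * (Δ ψ) x) volume :=
      (hP1.continuous.mul (continuous_laplacian hψ2)).integrable_of_hasCompactSupport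
        (hasCompactSupport_laplacian hc).mul_left
    have hI2 : Integrable (fun x => c * (Δ ψ) x) volume :=
      (continuous_const.mul (continuous_laplacian hψ2)).integrable_of_hasCompactSupport
        (hasCompactSupport_laplacian hc).mul_left
    rw [integral_sub hI1 hI2, integral_const_mul]
    have h0 : ∫ x, (Δ ψ) x = 0 := by
      simp_rw [← hdiv]
      exact integral_divergence_eq_zero hg1 hgc
    rw [h0, mul_zero, sub_zero]
  linarith

end Summit.NavierStokesRegularity.NavierStokesRegularity.Theorems.GaldiLiouville.AllAxesBudget

end
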